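import Literature.NumberTheory.LFunctions.PrimeTrigPolyFirstMoment
import Literature.NumberTheory.LFunctions.DirichletPolyBilinearMVT
import HarnessLib

/-!
# The first absolute moment of a prime trigonometric polynomial on a general window

Topic `Literature/NumberTheory/LFunctions`. Everything in this file is PROVED.

`Literature.NumberTheory.LFunctions.PrimeTrigPoly.first_moment_ge` bounds
`∫_T^{2T} |Im Σ_p a_p p^{it}| dt` from below; here the same argument (mean value theorem for the
second moment, the fourth moment through the squared polynomial, Hölder) is run on a window
`[U₁, U₂] ⊆ [0, ∞)` with `U₂ ≤ (5/2)(U₂ − U₁)` (e.g. `[9T/8, 15T/8]`), which is the window on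
which the smoothed `S(t+h) − S(t)` is compared with its prime sum in Selberg's lower bound for
`∫ |S(t+h) − S(t)| dt` (Titchmarsh §9.26).

## References

* E. C. Titchmarsh, *The Theory of the Riemann Zeta-Function*, 2nd ed. (1986), §9.25–9.26.
  [cite: Titchmarsh1986, §9.26]
* A. Ivić, *The Riemann Zeta-Function* (1985), Theorem 5.2. [cite: Ivic1985, Theorem 5.2]
-/

noncomputable section

open Complex MeasureTheory intervalIntegral

namespace Literature.NumberTheory.LFunctions

namespace PrimeTrigPoly

variable {S : Finset ℕ} {a : ℕ → ℂ} {N : ℕ}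

/-- **The first absolute moment on a window.** Let `S` be a finite set of primes `≤ N`,
`a : ℕ → ℂ`, `V = Σ_{p∈S} |a_p|²`, and `0 ≤ U₁ ≤ U₂` with `W = U₂ − U₁`, `2U₂ ≤ 5W`, `1856 N² ≤ W`
and `1856 Σ_{p∈S} p|a_p|² + 4 (Σ_{p∈S} |a_p|)² ≤ W V/2`. Then
`∫_{U₁}^{U₂} |Im Σ_{p∈S} a_p p^{it}| dt ≥ W √V / 20`. The proof is that of `first_moment_ge`:
`∫ F² ≥ WV/4` (`abs_integral_norm_sq_dirichletPoly_sub_le`, `norm_integral_primePoly_sq_le`),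
`∫ F⁴ ≤ ∫_0^{U₂} |Z²|² ≤ (U₂ + 928 N²)·2V² ≤ 6 W V²`, and `(∫F²)³ ≤ (∫|F|)² ∫F⁴`.
[cite: Titchmarsh1986, §9.26] [cite: Ivic1985, Theorem 5.2] -/
theorem first_moment_ge_window (hP : ∀ p ∈ S, p.Prime) (hS : S ⊆ Finset.Icc 1 N) {U₁ U₂ : ℝ}
    (hU₁ : 0 ≤ U₁) (hU : U₁ ≤ U₂) (hU₂ : 2 * U₂ ≤ 5 * (U₂ - U₁))
    (hN : 1856 * (N : ℝ) ^ 2 ≤ U₂ - U₁)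
    (hsmall : 1856 * (∑ p ∈ S, (p : ℝ) * ‖a p‖ ^ 2) + 4 * (∑ p ∈ S, ‖a p‖) ^ 2 ≤
      (U₂ - U₁) * (∑ p ∈ S, ‖a p‖ ^ 2) / 2) :
    (U₂ - U₁) * Real.sqrt (∑ p ∈ S, ‖a p‖ ^ 2) / 20 ≤
      ∫ t in U₁..U₂, |(∑ p ∈ S, a p * (p : ℂ) ^ ((t : ℂ) * I)).im| := by
  set V := ∑ p ∈ S, ‖a p‖ ^ 2 with hV
  set W := U₂ - U₁ with hW
  have hW0 : 0 ≤ W := by rw [hW]; linarith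
  have hV0 : 0 ≤ V := Finset.sum_nonneg fun p _ ↦ sq_nonneg _
  have h2S : ∀ p ∈ S, 2 ≤ p := fun p hp ↦ (hP p hp).two_le
  have hcont : Continuous fun t : ℝ ↦ ∑ p ∈ S, a p * (p : ℂ) ^ ((t : ℂ) * I) := continuous_primePoly hS
  set F : ℝ → ℝ := fun t ↦ ((∑ p ∈ S, a p * (p : ℂ) ^ ((t : ℂ) * I))).im with hFdef
  have hFc : Continuous F := Complex.continuous_im.comp hcont
  -- second moment from below
  have hI2 : W * V / 4 ≤ ∫ t in U₁..U₂, F t ^ 2 := by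
    have hw := abs_integral_norm_sq_dirichletPoly_sub_le N (fun n : ℕ ↦ if n ∈ S then a n else (0 : ℂ)) U₁ U₂
    rw [sum_norm_sq_restrictCoeff hS, sum_mul_norm_sq_restrictCoeff hS] at hw
    have hdir : ∀ t : ℝ, ‖∑ n ∈ Finset.Icc 1 N, (if n ∈ S then a n else (0 : ℂ)) * (n : ℂ) ^ ((t : ℂ) * I)‖ ^ 2 =
        ‖(∑ p ∈ S, a p * (p : ℂ) ^ ((t : ℂ) * I))‖ ^ 2 := fun t ↦ by
      rw [primePoly_eq_dirPoly hS]
    simp_rw [hdir] at hw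
    rw [← hV, ← hW] at hw
    have hZ2 := norm_integral_primePoly_sq_le (a := a) h2S U₁ U₂
    have hi1 : IntervalIntegrable (fun t ↦ ‖(∑ p ∈ S, a p * (p : ℂ) ^ ((t : ℂ) * I))‖ ^ 2) volume U₁ U₂ :=
      (hcont.norm.pow 2).intervalIntegrable _ _
    have hi2 : IntervalIntegrable (fun t ↦ ((∑ p ∈ S, a p * (p : ℂ) ^ ((t : ℂ) * I)) ^ 2).re) volume U₁ U₂ :=
      (Complex.continuous_re.comp (hcont.pow 2)).intervalIntegrable _ _
    have hre := intervalIntegral_re (μ := volume) (f := fun t : ℝ ↦ (∑ p ∈ S, a p * (p : ℂ) ^ ((t : ℂ) * I)) ^ 2)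
      ((hcont.pow 2).intervalIntegrable U₁ U₂)
    simp only [RCLike.re_to_complex] at hre
    have e : ∫ t in U₁..U₂, F t ^ 2 =
        ∫ t in U₁..U₂, (‖(∑ p ∈ S, a p * (p : ℂ) ^ ((t : ℂ) * I))‖ ^ 2 - ((∑ p ∈ S, a p * (p : ℂ) ^ ((t : ℂ) * I)) ^ 2).re) / 2 :=
      intervalIntegral.integral_congr fun t _ ↦ im_sq_eq _
    rw [e, intervalIntegral.integral_div, intervalIntegral.integral_sub hi1 hi2, hre]
    have hre_le : (∫ t in U₁..U₂, (∑ p ∈ S, a p * (p : ℂ) ^ ((t : ℂ) * I)) ^ 2).re ≤ 4 * (∑ p ∈ S, ‖a p‖) ^ 2 :=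
      (Complex.re_le_norm _).trans hZ2
    have hw' := (abs_le.1 hw).1
    linarith
  -- fourth moment from above
  have hI4 : ∫ t in U₁..U₂, F t ^ 4 ≤ 6 * W * V ^ 2 := by
    have hmono : ∫ t in U₁..U₂, F t ^ 4 ≤ ∫ t in U₁..U₂, ‖(∑ p ∈ S, a p * (p : ℂ) ^ ((t : ℂ) * I)) ^ 2‖ ^ 2 :=
      intervalIntegral.integral_mono_on hU ((hFc.pow 4).intervalIntegrable _ _)
        ((((hcont.pow 2).norm).pow 2).intervalIntegrable _ _) fun t _ ↦ im_pow_four_le _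
    have hext : ∫ t in U₁..U₂, ‖(∑ p ∈ S, a p * (p : ℂ) ^ ((t : ℂ) * I)) ^ 2‖ ^ 2 ≤
        ∫ t in (0 : ℝ)..U₂, ‖(∑ p ∈ S, a p * (p : ℂ) ^ ((t : ℂ) * I)) ^ 2‖ ^ 2 :=
      intervalIntegral.integral_mono_interval hU₁ hU le_rfl
        (Filter.Eventually.of_forall fun t ↦ by positivity)
        ((((hcont.pow 2).norm).pow 2).intervalIntegrable _ _)
    have h52 := integral_norm_sq_dirichletPoly_sub_le (N * N) (fun k : ℕ ↦ ∑ x ∈ (S ×ˢ S).filter (fun x ↦ x.1 * x.2 = k), a x.1 * a x.2) U₂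
    have hdir : ∀ t : ℝ, ‖(∑ k ∈ Finset.Icc 1 (N * N), (∑ x ∈ (S ×ˢ S).filter (fun x ↦ x.1 * x.2 = k), a x.1 * a x.2) * (k : ℂ) ^ ((t : ℂ) * I))‖ ^ 2 = ‖(∑ p ∈ S, a p * (p : ℂ) ^ ((t : ℂ) * I)) ^ 2‖ ^ 2 :=
      fun t ↦ by rw [primePoly_sq_eq hS]
    simp_rw [hdir] at h52
    have hc1 := sum_norm_sq_sqCoeff_le (a := a) hP hS
    have hc2 := sum_mul_norm_sq_sqCoeff_le (a := a) hP hS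
    rw [← hV] at hc1 hc2
    have h52' := (abs_le.1 h52).2
    have hU₂0 : 0 ≤ U₂ := le_trans hU₁ hU
    have p1 := mul_le_mul_of_nonneg_left hc1 hU₂0
    have p2 : 928 * ∑ k ∈ Finset.Icc 1 (N * N), (k : ℝ) * ‖(∑ x ∈ (S ×ˢ S).filter (fun x ↦ x.1 * x.2 = k), a x.1 * a x.2)‖ ^ 2 ≤
        928 * (2 * (N : ℝ) ^ 2 * V ^ 2) := by linarith
    have hV2 : 0 ≤ V ^ 2 := sq_nonneg _
    have p3 : 928 * (2 * (N : ℝ) ^ 2 * V ^ 2) ≤ W * V ^ 2 := by nlinarith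
    have p4 : U₂ * (2 * V ^ 2) ≤ 5 * W * V ^ 2 := by nlinarith
    linarith
  -- Hölder and the arithmetic
  have hH := pow_three_integral_sq_le hFc hU
  have hA0 : 0 ≤ ∫ t in U₁..U₂, |F t| := intervalIntegral.integral_nonneg hU fun t _ ↦ abs_nonneg _
  rcases hV0.eq_or_lt with hV00 | hVpos
  · rw [← hV00, Real.sqrt_zero, mul_zero, zero_div]; exact hA0
  rcases hW0.eq_or_lt with hW00 | hWpos
  · rw [← hW00, zero_mul, zero_div]; exact hA0
  have hWV : 0 < W * V / 4 := by positivity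
  have h1 : (W * V / 4) ^ 3 ≤ (∫ t in U₁..U₂, |F t|) ^ 2 * (6 * W * V ^ 2) :=
    calc (W * V / 4) ^ 3 ≤ (∫ t in U₁..U₂, F t ^ 2) ^ 3 := pow_le_pow_left₀ hWV.le hI2 3
      _ ≤ (∫ t in U₁..U₂, |F t|) ^ 2 * ∫ t in U₁..U₂, F t ^ 4 := hH
      _ ≤ (∫ t in U₁..U₂, |F t|) ^ 2 * (6 * W * V ^ 2) :=
          mul_le_mul_of_nonneg_left hI4 (sq_nonneg _)
  have h2 : (W * Real.sqrt V / 20) ^ 2 ≤ (∫ t in U₁..U₂, |F t|) ^ 2 := by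
    have hsq : (W * Real.sqrt V / 20) ^ 2 = W ^ 2 * V / 400 := by
      rw [div_pow, mul_pow, Real.sq_sqrt hV0]; norm_num
    rw [hsq]
    have h3 : W ^ 2 * V / 384 * (6 * W * V ^ 2) = (W * V / 4) ^ 3 := by ring
    have h4 : W ^ 2 * V / 384 ≤ (∫ t in U₁..U₂, |F t|) ^ 2 :=
      le_of_mul_le_mul_right (h3 ▸ h1) (by positivity)
    nlinarith
  exact (pow_le_pow_iff_left₀ (by positivity) hA0 two_ne_zero).1 h2

end PrimeTrigPoly

end Literature.NumberTheory.LFunctions
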